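import Batteries.Tactic.GeneralizeProofs
import Literature.AnabelianGeometry.SemiGraphs.LocalizationSquareLaws

/-!
# [SemiAnbd] Def 4.1 (iv) — merge step M4 part 3e: induced morphisms descend to 2-iso classes

Additive over `LocalizationSquareLaws`: a 2-cell `σ : φ ≅ φ'` induces a 2-cell between the
1-morphisms induced over a commutative square (`HomOver.inducedAlongSquare`), so that
`𝒢[v] → ℋ[f v]` / `𝒢[e] → ℋ[f e]` are well defined on the arrows of the 1-category `SgAQuot`
(container datum `locMapV` / `locMapE` at the real vocabulary). Construction only.
[cite: MochizukiSemiAnbd2006, Def 4.1 (iv), p. 51; Rmk 2.4.2, p. 26]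
-/

namespace Literature.AnabelianGeometry.SemiGraphs

open CategoryTheory

universe v₁ u₁ u

namespace SemiGraphOfAnabelioids

variable {𝒢 ℋ : SemiGraphOfAnabelioids.{v₁, u₁, u}} {f : 𝒢.graph ⟶ ℋ.graph}
  {φ φ' : HomOver 𝒢 ℋ f}

/-- Transport naturality of the edge 2-cells of a 2-isomorphism: reading `σ.isoE` at transported
presentations is conjugation by transports (identity after `subst`).
[cite: MochizukiSemiAnbd2006, Rmk 2.4.2, p. 26] -/
theorem HomOver.Iso2.isoE_transport_app (σ : HomOver.Iso2 φ φ') (E₁ E₀ : 𝒢.graph.Edge)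
    (p : E₁ = E₀) (y₁ y₀ : ℋ.graph.Edge) (p₂ : y₁ = y₀) (q : f.edgeMap E₁ = y₁)
    (q₁ : f.edgeMap E₀ = y₀) (A : ℋ.E y₀) (B : ℋ.E y₁)
    (hAB : B = (ℋ.idE y₁ y₀ p₂).pullback.obj A) :
    eqToHom (by subst hAB; subst p; subst p₂; rfl) ≫ (σ.isoE E₁ y₁ q).hom.app B =
      (𝒢.idE E₁ E₀ p).pullback.map ((σ.isoE E₀ y₀ q₁).hom.app A) ≫
        eqToHom (by subst hAB; subst p; subst p₂; rfl) := by
  subst hAB; subst p; subst p₂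
  simp only [idE_rfl, Anabelioids.Hom.id_pullback, Functor.id_obj, Functor.id_map,
    eqToHom_refl, Category.id_comp, Category.comp_id]

/-- The object identification behind the square 2-cells (identity after `subst`).
[cite: MochizukiSemiAnbd2006, Rmk 2.4.2, p. 26] -/
theorem pull_obj_transport (β₁ : 𝒢.graph.Branch) (v₁ : 𝒢.graph.Vertex) (β₂ : ℋ.graph.Branch)
    (v₂ : ℋ.graph.Vertex) (hβ : f.branchMap β₁ = β₂) (hv : f.vertexMap v₁ = v₂)
    (y₁ : ℋ.graph.Edge) (p₂ : y₁ = ℋ.graph.edgeOf β₂)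
    (hb : ℋ.graph.abuts (f.branchMap β₁) = some (f.vertexMap v₁))
    (hb' : ℋ.graph.abuts β₂ = some v₂) (X : ℋ.V v₂) :
    (ℋ.idE y₁ _ p₂).pullback.obj ((ℋ.pull β₂ v₂ hb').pullback.obj X) =
      (ℋ.idE y₁ _ (p₂.trans (by subst hβ; rfl))).pullback.obj
        ((ℋ.pull (f.branchMap β₁) (f.vertexMap v₁) hb).pullback.obj
          ((ℋ.idV (f.vertexMap v₁) v₂ hv).pullback.obj X)) := by
  subst hβ; subst hv; rfl

variable {H₁ H₂ : SemiGraph.{u}}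

/-- **Induced 1-morphisms over a square descend to 2-isomorphism classes**: a 2-cell `φ ≅ φ'`
induces a 2-cell between the induced 1-morphisms `𝒢_{ι₁} → ℋ_{ι₂}`.
[cite: MochizukiSemiAnbd2006, Def 4.1 (iv), p. 51] -/
noncomputable def HomOver.Iso2.inducedAlongSquare (σ : HomOver.Iso2 φ φ') (ι₁ : H₁ ⟶ 𝒢.graph)
    (ι₂ : H₂ ⟶ ℋ.graph) (κ : H₁ ⟶ H₂) (r : ι₁ ≫ f = κ ≫ ι₂) :
    HomOver.Iso2 (φ.inducedAlongSquare ι₁ ι₂ κ r) (φ'.inducedAlongSquare ι₁ ι₂ κ r) where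
  isoV w :=
    Functor.isoWhiskerLeft
      (ℋ.idV (f.vertexMap (ι₁.vertexMap w)) (ι₂.vertexMap (κ.vertexMap w))
        (congrArg (fun t : H₁ ⟶ ℋ.graph => t.vertexMap w) r)).pullback
      (σ.isoV (ι₁.vertexMap w))
  isoE e e' h :=
    σ.isoE (ι₁.edgeMap e) (ι₂.edgeMap e')
      ((congrArg (fun t : H₁ ⟶ ℋ.graph => t.edgeMap e) r).trans (congrArg ι₂.edgeMap h))
  coh c w hc := by
    ext X
    have hcoh := congrArg (fun t => t.hom.app
      ((ℋ.idV (f.vertexMap (ι₁.vertexMap w)) (ι₂.vertexMap (κ.vertexMap w))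
        (congrArg (fun t : H₁ ⟶ ℋ.graph => t.vertexMap w) r)).pullback.obj X))
      (σ.coh (ι₁.branchMap c) (ι₁.vertexMap w) (ι₁.abuts_branchMap c w hc))
    simp only [Iso.trans_hom, NatTrans.comp_app, Functor.isoWhiskerLeft_hom,
      Functor.whiskerLeft_app, Functor.isoWhiskerRight_hom, Functor.whiskerRight_app] at hcoh
    simp only [Iso.trans_hom, NatTrans.comp_app, Functor.isoWhiskerLeft_hom,
      Functor.whiskerLeft_app, Functor.isoWhiskerRight_hom, Functor.whiskerRight_app,
      HomOver.inducedAlongSquare, HomOver.squareCell_hom_app, Anabelioids.Hom.comp_pullback,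
      Functor.comp_map]
    erw [← Functor.map_comp_assoc, ← hcoh, Functor.map_comp_assoc]
    have key := σ.isoE_transport_app (ι₁.edgeMap (H₁.edgeOf c))
      (𝒢.graph.edgeOf (ι₁.branchMap c)) (ι₁.edgeOf_branchMap c).symm _ _ _
      ((congrArg (fun t : H₁ ⟶ ℋ.graph => t.edgeMap (H₁.edgeOf c)) r).trans
        (congrArg ι₂.edgeMap (κ.edgeOf_branchMap c).symm))
      (f.edgeOf_branchMap (ι₁.branchMap c)).symm _ _
      (pull_obj_transport (ι₁.branchMap c) (ι₁.vertexMap w) (ι₂.branchMap (κ.branchMap c))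
        (ι₂.vertexMap (κ.vertexMap w)) (congrArg (fun t : H₁ ⟶ ℋ.graph => t.branchMap c) r)
        (congrArg (fun t : H₁ ⟶ ℋ.graph => t.vertexMap w) r)
        (ι₂.edgeMap (H₂.edgeOf (κ.branchMap c))) (ι₂.edgeOf_branchMap (κ.branchMap c)).symm
        (f.abuts_branchMap _ _ (ι₁.abuts_branchMap c w hc))
        (ι₂.abuts_branchMap _ _ (κ.abuts_branchMap c w hc)) X)
    erw [Category.assoc, key]
    rfl

/-- **Congruence**: 2-isomorphic 1-morphisms induce the same arrow `𝒢_{ι₁} → ℋ_{ι₂}` of the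
1-category. [cite: MochizukiSemiAnbd2006, Def 4.1 (iv), p. 51] -/
theorem HomOver.homMk_inducedAlongSquare_congr (h : Nonempty (HomOver.Iso2 φ φ'))
    (ι₁ : H₁ ⟶ 𝒢.graph) (ι₂ : H₂ ⟶ ℋ.graph) (κ : H₁ ⟶ H₂) (r : ι₁ ≫ f = κ ≫ ι₂) :
    (SgAQuot.homMk (φ.inducedAlongSquare ι₁ ι₂ κ r) :
        SgAQuot.mk (𝒢.inducedAlong ι₁) ⟶ SgAQuot.mk (ℋ.inducedAlong ι₂)) =
      SgAQuot.homMk (φ'.inducedAlongSquare ι₁ ι₂ κ r) :=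
  (SgAQuot.homMk_eq_homMk_iff _ _).mpr ⟨h.some.inducedAlongSquare ι₁ ι₂ κ r⟩

/-- Congruence for `𝒢[v] → ℋ[f v]`. [cite: MochizukiSemiAnbd2006, Def 4.1 (iv), p. 51] -/
theorem HomOver.homOf_atVertexMap_congr (h : Nonempty (HomOver.Iso2 φ φ'))
    (v : 𝒢.graph.Vertex) :
    SgAQuot.homOf (φ.atVertexMap v) = SgAQuot.homOf (φ'.atVertexMap v) :=
  HomOver.homMk_inducedAlongSquare_congr h _ _ _
    (SemiGraph.atVertexMap_comp_atVertexHom f v).symm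

/-- Congruence for `𝒢[e] → ℋ[f e]`. [cite: MochizukiSemiAnbd2006, Def 4.1 (iv), p. 51] -/
theorem HomOver.homOf_atEdgeMap_congr (h : Nonempty (HomOver.Iso2 φ φ'))
    (e : 𝒢.graph.Edge) :
    SgAQuot.homOf (φ.atEdgeMap e) = SgAQuot.homOf (φ'.atEdgeMap e) :=
  HomOver.homMk_inducedAlongSquare_congr h _ _ _
    (SemiGraph.atEdgeMap_comp_atEdgeHom f e).symm

end SemiGraphOfAnabelioids

/-! ### The induced arrows on the 1-category (container data `locMapV`, `locMapE`) -/

namespace SgAQuot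

open SemiGraphOfAnabelioids

variable {X Y Z : SgAQuot.{v₁, u₁, u}}

/-- **`𝒢[v] → ℋ[f v]` on arrows of the 1-category** (well defined by
`HomOver.homOf_atVertexMap_congr`). [cite: MochizukiSemiAnbd2006, Def 4.1 (iv), p. 51] -/
noncomputable def Hom.atVertexMap (F : X ⟶ Y) (v : X.toSgA.graph.Vertex) :
    SgAQuot.mk (X.toSgA.atVertex v) ⟶ SgAQuot.mk (Y.toSgA.atVertex (F.base.vertexMap v)) :=
  Quotient.liftOn F.cls (fun φ => SgAQuot.homOf (φ.atVertexMap v))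
    fun _ _ h => HomOver.homOf_atVertexMap_congr h v

/-- **`𝒢[e] → ℋ[f e]` on arrows of the 1-category.** [cite: MochizukiSemiAnbd2006, Def 4.1 (iv), p. 51] -/
noncomputable def Hom.atEdgeMap (F : X ⟶ Y) (e : X.toSgA.graph.Edge) :
    SgAQuot.mk (X.toSgA.atEdge e) ⟶ SgAQuot.mk (Y.toSgA.atEdge (F.base.edgeMap e)) :=
  Quotient.liftOn F.cls (fun φ => SgAQuot.homOf (φ.atEdgeMap e))
    fun _ _ h => HomOver.homOf_atEdgeMap_congr h e

/-- Computation rule on classes of 1-morphisms. [cite: MochizukiSemiAnbd2006, Def 4.1 (iv), p. 51] -/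
theorem Hom.atVertexMap_homMk {f : X.toSgA.graph ⟶ Y.toSgA.graph}
    (φ : HomOver X.toSgA Y.toSgA f) (v : X.toSgA.graph.Vertex) :
    Hom.atVertexMap (homMk φ) v = homOf (φ.atVertexMap v) := rfl

/-- Computation rule on classes of 1-morphisms. [cite: MochizukiSemiAnbd2006, Def 4.1 (iv), p. 51] -/
theorem Hom.atEdgeMap_homMk {f : X.toSgA.graph ⟶ Y.toSgA.graph}
    (φ : HomOver X.toSgA Y.toSgA f) (e : X.toSgA.graph.Edge) :
    Hom.atEdgeMap (homMk φ) e = homOf (φ.atEdgeMap e) := rfl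

/-- **Law `locMapV_ι`: `(X[v] → Y[F v]) ≫ (Y[F v] → Y) = (X[v] → X) ≫ F`.**
[cite: MochizukiSemiAnbd2006, Def 4.1 (iv), p. 51] -/
theorem Hom.atVertexMap_comp_atVertexHom (F : X ⟶ Y) (v : X.toSgA.graph.Vertex) :
    Hom.atVertexMap F v ≫ homOf (Y.toSgA.atVertexHom (F.base.vertexMap v)) =
      homOf (X.toSgA.atVertexHom v) ≫ F := by
  obtain ⟨f, a⟩ := F
  induction a using Quotient.ind with
  | _ φ => exact SemiGraphOfAnabelioids.homOf_atVertexMap_comp φ.toHom v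

/-- **Law `locMapE_ι`: `(X[e] → Y[F e]) ≫ (Y[F e] → Y) = (X[e] → X) ≫ F`.**
[cite: MochizukiSemiAnbd2006, Def 4.1 (iv), p. 51] -/
theorem Hom.atEdgeMap_comp_atEdgeHom (F : X ⟶ Y) (e : X.toSgA.graph.Edge) :
    Hom.atEdgeMap F e ≫ homOf (Y.toSgA.atEdgeHom (F.base.edgeMap e)) =
      homOf (X.toSgA.atEdgeHom e) ≫ F := by
  obtain ⟨f, a⟩ := F
  induction a using Quotient.ind with
  | _ φ => exact SemiGraphOfAnabelioids.homOf_atEdgeMap_comp φ.toHom e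

/-- **Law `locMapV_id`: the identity induces the identity `X[v] → X[v]`.**
[cite: MochizukiSemiAnbd2006, Def 4.1 (iv), p. 51] -/
theorem Hom.atVertexMap_id (X : SgAQuot.{v₁, u₁, u}) (v : X.toSgA.graph.Vertex) :
    Hom.atVertexMap (𝟙 X) v = 𝟙 (SgAQuot.mk (X.toSgA.atVertex v)) :=
  SemiGraphOfAnabelioids.homOf_atVertexMap_id X.toSgA v

/-- **Law `locMapE_id`: the identity induces the identity `X[e] → X[e]`.**
[cite: MochizukiSemiAnbd2006, Def 4.1 (iv), p. 51] -/
theorem Hom.atEdgeMap_id (X : SgAQuot.{v₁, u₁, u}) (e : X.toSgA.graph.Edge) :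
    Hom.atEdgeMap (𝟙 X) e = 𝟙 (SgAQuot.mk (X.toSgA.atEdge e)) :=
  SemiGraphOfAnabelioids.homOf_atEdgeMap_id X.toSgA e

end SgAQuot

end Literature.AnabelianGeometry.SemiGraphs
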